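import Literature.Barriers.CriticalPhenomena.PlaquetteWalkHoleRootKillSignSchema
import HarnessLib

/-!
# Barrier catalogue (SAWScalingLimit): LAW L CERTIFIED — the dead-end column variant of the western sign schemas, and
eleven predicted kills of the corner-kill table as closed sign theorems for named frames

Leaf of `PlaquetteWalkHoleRootKillSignSchema` (the four structural SIGN schemas: one absent corner cell two rows from the far
cell / root plaquette + the 22-cell witness block fix the sign of `Im VF` at `π/3` or `2π/3`, every domain, every
position). Two additions:

* §1 the WESTERN schemas with the quadrant leaf's THREE-way column condition (no western door below / above the kill row,
  OR the western neighbour a DEAD END) — `im_vertexFunctional_printed_pi_div_three_pos_of_killSW_block'`,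
  `…_two_pi_div_three_neg_of_killNW_block'` (and their reference-position forms): this covers a western kill cell on the
  WEST WALL of a box at any height, where the corner cell below (above) it is a dead end — the venture lane's frames
  with the hole three rows up (`66c`, `66d`, `57a`).
* §2 **LAW L CERTIFIED**: eleven of the 33 kills predicted (and observed) in the lane's pre-registered corner-kill table
  (`FINDING-YB-KILL-FORCED-ZEROS.md` §5) as CLOSED sign theorems for the exact domains `box ∖ {hole, K}` — frame `75a`
  (`7×5 ∖ (3,2)`: `(1,0)` ⇒ `Im VF(π/3) > 0`, `(1,4)` ⇒ `Im VF(2π/3) < 0`, `(5,0)` ⇒ `Im VF(2π/3) > 0`, `(5,4)` ⇒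
  `Im VF(π/3) < 0`), frame `66c` (`6×6 ∖ (2,3)`: `(0,1)`, `(0,5)` by the dead-end clause, `(4,5)` on the top wall),
  frame `85b` (`8×5 ∖ (4,2)`: `(2,0)`, `(2,4)` with two live columns west of the pocket, `(6,0)`, `(6,4)` with a live
  column east): `frame75a_KS2_sign`, …, `frame85b_KN2_sign`. Each is the schema instantiated with block membership,
  absences and column conditions decided on the face list — a non-vacuity check of the schemas' hypotheses on the
  lane's own frames, and the table's rows as theorems (the table records zero COUNTS of free walks; the sign of
  `Im VF = ±x_c²·(M_N − M_S)` resp. `±v·(…)` is their vertex-functional form, `PlaquetteWalkHoleRootKillForcedZeros` §1).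

Not in print; venture lane «pcv-sawmu», seat b-step0 gen 25.

References: A. Glazman, I. Manolescu, arXiv:1708.00395v3, §1, §2.1, §4.2 and Lemma 2.1 [GlazmanManolescu2019];
A. Glazman, Electron. Commun. Probab. 20 (2015) no. 86, Lemma 3.1 [Glazman2015WeightedSAW]; R. Courant, H. Robbins,
*What is Mathematics?* (1941/1958), Ch. V Appendix §2 [CourantRobbins1958]; H. Duminil-Copin, S. Smirnov, Ann. of Math.
175 (2012), Lemma 1 [DuminilCopinSmirnov2012].
-/

noncomputable section

open Set Function Complex

namespace Literature.Barriers.CriticalPhenomena.PlaquetteWalk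

open Literature.Probability.RandomPlanarGeometry.SAW.YangBaxter
open Real Complex

/-! ## §1 The western schemas with the dead-end clause (kill cells on the west wall at any height) -/

section WestDeadEnd

variable {Dl : List Face} {w : Face}

/-- ★★★★ **`K_S2` ⇒ `Im VF(π/3) > 0`, reference position, dead-end form**: the column condition in the quadrant leaf's
three-way form — below the kill row the far cell's column has no western door, OR its western neighbour is a dead end
(its `W`, `S`, `N` neighbours absent; met by the corner cell of a box when the hole sits three rows up).
[cite: GlazmanManolescu2019, Lemma 2.1 (statement, "in the form given in [Gl]")] [cite: GlazmanManolescu2019, §1 (the paragraph of Fig. 2)] -/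
theorem im_pos_pi_div_three_of_killSW_block42' (hB : ∀ c ∈ westBlock42, c ∈ Dl) (hh : holeFaceW w42 ∉ dom Dl)
    (hKS : killSW w42 ∉ dom Dl)
    (hcolS : ∀ y : ℤ, y ≤ w42.2 - 3 → (w42.1 - 3, y) ∉ dom Dl ∨ (w42.1 - 2, y) ∉ dom Dl ∨
      (((w42.1 - 4, y) : Face) ∉ dom Dl ∧ ((w42.1 - 3, y - 1) : Face) ∉ dom Dl ∧ ((w42.1 - 3, y + 1) : Face) ∉ dom Dl)) :
    0 < (vertexFunctional (printedWeights (π / 3)) tFiveEighths (ybCoeff (π / 3)) Dl (w42.side .W) (farW w42)).im := by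
  have hf : farW w42 ∈ Dl := hB _ (by decide)
  have hr := rootedFace_of_farW_mem_of_hole hf hh
  exact im_vertexFunctional_printed_farCellW_pi_div_three_pos_of_under_killed Dl w42 hf hh hr
    (ΩG.under_killed_of_killSW_quadrant hh hKS hcolS hr _) (exists_over_witness_of_westBlock42 hB hr _)

/-- ★★★★ **`K_N1` ⇒ `Im VF(2π/3) < 0`, reference position, dead-end form.** [cite: GlazmanManolescu2019, Lemma 2.1 (statement, "in the form given in [Gl]")]
[cite: GlazmanManolescu2019, §1, remark after eq. (1)] -/
theorem im_neg_two_pi_div_three_of_killNW_block42' (hB : ∀ c ∈ westBlock42, c ∈ Dl) (hh : holeFaceW w42 ∉ dom Dl)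
    (hKN : killNW w42 ∉ dom Dl)
    (hcolN : ∀ y : ℤ, w42.2 + 3 ≤ y → (w42.1 - 3, y) ∉ dom Dl ∨ (w42.1 - 2, y) ∉ dom Dl ∨
      (((w42.1 - 4, y) : Face) ∉ dom Dl ∧ ((w42.1 - 3, y + 1) : Face) ∉ dom Dl ∧ ((w42.1 - 3, y - 1) : Face) ∉ dom Dl)) :
    (vertexFunctional (printedWeights (2 * π / 3)) tFiveEighths (ybCoeff (2 * π / 3)) Dl (w42.side .W) (farW w42)).im < 0 := by
  have hf : farW w42 ∈ Dl := hB _ (by decide)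
  have hr := rootedFace_of_farW_mem_of_hole hf hh
  exact im_vertexFunctional_printed_farCellW_two_pi_div_three_neg_of_over_killed Dl w42 hf hh hr
    (ΩG.over_killed_of_killNW_quadrant hh hKN hcolN hr _) (exists_under_witness_of_westBlock42 hB hr _)

/-- Transport of the dead-end triple to the reference position. [cite: GlazmanManolescu2019, §4.2 (translation invariance)] -/
private theorem deadEnd_refShift {y : ℤ}
    (h : ((w.1 - 4, y + (w.2 - 2)) : Face) ∉ dom Dl ∧ ((w.1 - 3, y + (w.2 - 2) - 1) : Face) ∉ dom Dl ∧
      ((w.1 - 3, y + (w.2 - 2) + 1) : Face) ∉ dom Dl) :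
    ((0, y) : Face) ∉ dom (Dl.map (Face.shiftBy (-refShift w))) ∧
      ((1, y - 1) : Face) ∉ dom (Dl.map (Face.shiftBy (-refShift w))) ∧
        ((1, y + 1) : Face) ∉ dom (Dl.map (Face.shiftBy (-refShift w))) := by
  obtain ⟨h1, h2, h3⟩ := h
  refine ⟨not_mem_refShift 0 y ?_, not_mem_refShift 1 (y - 1) ?_, not_mem_refShift 1 (y + 1) ?_⟩
  · have e : ((0 + (w.1 - 4), y + (w.2 - 2)) : Face) = (w.1 - 4, y + (w.2 - 2)) := Prod.ext (by show 0 + (w.1 - 4) = w.1 - 4; ring) rfl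
    rw [e]; exact h1
  · have e : ((1 + (w.1 - 4), y - 1 + (w.2 - 2)) : Face) = (w.1 - 3, y + (w.2 - 2) - 1) :=
      Prod.ext (by show 1 + (w.1 - 4) = w.1 - 3; ring) (by show y - 1 + (w.2 - 2) = y + (w.2 - 2) - 1; ring)
    rw [e]; exact h2
  · have e : ((1 + (w.1 - 4), y + 1 + (w.2 - 2)) : Face) = (w.1 - 3, y + (w.2 - 2) + 1) :=
      Prod.ext (by show 1 + (w.1 - 4) = w.1 - 3; ring) (by show y + 1 + (w.2 - 2) = y + (w.2 - 2) + 1; ring)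
    rw [e]; exact h3

/-- ★★★★★ **`K_S2` ⇒ `Im VF(π/3) > 0`, EVERY POSITION, dead-end form** — covers a western kill cell on the west wall of a box at
ANY height (the corner cell below it is then a dead end). [cite: GlazmanManolescu2019, Lemma 2.1, §4.2]
[cite: GlazmanManolescu2019, §1 (the paragraph of Fig. 2)] [cite: CourantRobbins1958, Ch. V Appendix §2 (the even–odd rule)] -/
theorem im_vertexFunctional_printed_pi_div_three_pos_of_killSW_block' (hB : ∀ c ∈ westBlock w, c ∈ Dl)
    (hh : holeFaceW w ∉ dom Dl) (hKS : killSW w ∉ dom Dl)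
    (hcolS : ∀ y : ℤ, y ≤ w.2 - 3 → (w.1 - 3, y) ∉ dom Dl ∨ (w.1 - 2, y) ∉ dom Dl ∨
      (((w.1 - 4, y) : Face) ∉ dom Dl ∧ ((w.1 - 3, y - 1) : Face) ∉ dom Dl ∧ ((w.1 - 3, y + 1) : Face) ∉ dom Dl)) :
    0 < (vertexFunctional (printedWeights (π / 3)) tFiveEighths (ybCoeff (π / 3)) Dl (w.side .W) (farW w)).im := by
  rw [vertexFunctional_printed_eq_refShift Dl w]
  refine im_pos_pi_div_three_of_killSW_block42' (westBlock42_mem_of_westBlock hB) ?_ ?_ ?_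
  · rw [mem_dom_map_shiftBy_neg, shiftBy_refShift_holeFaceW]; exact hh
  · refine not_mem_refShift 1 0 ?_
    have e : ((1 + (w.1 - 4), 0 + (w.2 - 2)) : Face) = killSW w := Prod.ext (by simp [killSW]; ring) (by simp [killSW])
    rw [e]; exact hKS
  · intro y hy
    simp only [w42] at hy ⊢
    rw [show ((4 : ℤ) - 3, y) = ((1 : ℤ), y) by norm_num, show ((4 : ℤ) - 2, y) = ((2 : ℤ), y) by norm_num,
      show ((4 : ℤ) - 4, y) = ((0 : ℤ), y) by norm_num]
    rcases hcolS (y + (w.2 - 2)) (by omega) with h | h | h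
    · left; refine not_mem_refShift 1 y ?_
      have e : ((1 + (w.1 - 4), y + (w.2 - 2)) : Face) = (w.1 - 3, y + (w.2 - 2)) := Prod.ext (by show 1 + (w.1 - 4) = w.1 - 3; ring) rfl
      rw [e]; exact h
    · right; left; refine not_mem_refShift 2 y ?_
      have e : ((2 + (w.1 - 4), y + (w.2 - 2)) : Face) = (w.1 - 2, y + (w.2 - 2)) := Prod.ext (by show 2 + (w.1 - 4) = w.1 - 2; ring) rfl
      rw [e]; exact h
    · right; right; exact deadEnd_refShift h

/-- ★★★★★ **`K_N1` ⇒ `Im VF(2π/3) < 0`, EVERY POSITION, dead-end form.** [cite: GlazmanManolescu2019, Lemma 2.1, §4.2]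
[cite: GlazmanManolescu2019, §1, remark after eq. (1)] [cite: CourantRobbins1958, Ch. V Appendix §2 (the even–odd rule)] -/
theorem im_vertexFunctional_printed_two_pi_div_three_neg_of_killNW_block' (hB : ∀ c ∈ westBlock w, c ∈ Dl)
    (hh : holeFaceW w ∉ dom Dl) (hKN : killNW w ∉ dom Dl)
    (hcolN : ∀ y : ℤ, w.2 + 3 ≤ y → (w.1 - 3, y) ∉ dom Dl ∨ (w.1 - 2, y) ∉ dom Dl ∨
      (((w.1 - 4, y) : Face) ∉ dom Dl ∧ ((w.1 - 3, y + 1) : Face) ∉ dom Dl ∧ ((w.1 - 3, y - 1) : Face) ∉ dom Dl)) :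
    (vertexFunctional (printedWeights (2 * π / 3)) tFiveEighths (ybCoeff (2 * π / 3)) Dl (w.side .W) (farW w)).im < 0 := by
  rw [vertexFunctional_printed_eq_refShift Dl w]
  refine im_neg_two_pi_div_three_of_killNW_block42' (westBlock42_mem_of_westBlock hB) ?_ ?_ ?_
  · rw [mem_dom_map_shiftBy_neg, shiftBy_refShift_holeFaceW]; exact hh
  · refine not_mem_refShift 1 4 ?_
    have e : ((1 + (w.1 - 4), 4 + (w.2 - 2)) : Face) = killNW w := Prod.ext (by simp [killNW]; ring) (by simp [killNW]; ring)
    rw [e]; exact hKN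
  · intro y hy
    simp only [w42] at hy ⊢
    rw [show ((4 : ℤ) - 3, y) = ((1 : ℤ), y) by norm_num, show ((4 : ℤ) - 2, y) = ((2 : ℤ), y) by norm_num,
      show ((4 : ℤ) - 4, y) = ((0 : ℤ), y) by norm_num]
    rcases hcolN (y + (w.2 - 2)) (by omega) with h | h | ⟨h1, h2, h3⟩
    · left; refine not_mem_refShift 1 y ?_
      have e : ((1 + (w.1 - 4), y + (w.2 - 2)) : Face) = (w.1 - 3, y + (w.2 - 2)) := Prod.ext (by show 1 + (w.1 - 4) = w.1 - 3; ring) rfl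
      rw [e]; exact h
    · right; left; refine not_mem_refShift 2 y ?_
      have e : ((2 + (w.1 - 4), y + (w.2 - 2)) : Face) = (w.1 - 2, y + (w.2 - 2)) := Prod.ext (by show 2 + (w.1 - 4) = w.1 - 2; ring) rfl
      rw [e]; exact h
    · right; right
      obtain ⟨e1, e2, e3⟩ := deadEnd_refShift (Dl := Dl) (w := w) (y := y) ⟨h1, h3, h2⟩
      exact ⟨e1, e3, e2⟩

end WestDeadEnd

/-! ## §2 LAW L CERTIFIED: the predicted single-removal kills of three frames as closed sign theorems

The venture lane's pre-registered LAW L (`FINDING-YB-KILL-FORCED-ZEROS.md` §5) predicts, per box frame `m×n ∖ h`, which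
single boundary-cell removals kill which route at which weight. Each predicted kill «cell `K`: route `S`/`N`, weight
`w₂`/`w₁`» is, at the level of the vertex functional, a SIGN of `Im VF` at `π/3` / `2π/3` for the domain `box ∖ {h, K}`;
here are eleven of the 33, for the frames `75a` (7×5, hole (3,2): all four corner cells on the boundary), `66c`
(6×6, hole (2,3): the west kills on the west wall one row off the corner — the dead-end clause — and the east kill
on the top wall), `85b` (8×5, hole (4,2): two live columns west of the pocket, one east of the eastern kills), each a
closed theorem obtained by instantiating the schemas (block membership, absences and column conditions decided on
the face lists). -/

/-- LAW L frame `75a` = `7×5 ∖ (3, 2)` with the kill cell `(1, 0)` removed alone. [cite: GlazmanManolescu2019, §2.1 (finite domains of faces)] -/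
def frame75a_KS2 : List Face := [(0,0),(0,1),(0,2),(0,3),(0,4),(1,1),(1,2),(1,3),(1,4),(2,0),(2,1),(2,2),(2,3),(2,4),(3,0),(3,1),(3,3),(3,4),(4,0),(4,1),(4,2),(4,3),(4,4),(5,0),(5,1),(5,2),(5,3),(5,4),(6,0),(6,1),(6,2),(6,3),(6,4)]

/-- ★ LAW L, frame `75a`, cell `(1, 0)` (KS2): the predicted sign, as a closed theorem. [cite: GlazmanManolescu2019, Lemma 2.1 (statement, "in the form given in [Gl]")] -/
theorem frame75a_KS2_sign : 0 < (vertexFunctional (printedWeights (π / 3)) tFiveEighths (ybCoeff (π / 3)) frame75a_KS2 (Face.side (4, 2) .W) (farW (4, 2))).im :=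
  im_vertexFunctional_printed_pi_div_three_pos_of_killSW_block' (Dl := frame75a_KS2) (w := (4, 2)) (by decide)
    (show holeFaceW (4, 2) ∉ frame75a_KS2 by decide) (show killSW (4, 2) ∉ frame75a_KS2 by decide)
    (fun y hy => Or.inl (show ((_ : ℤ), y) ∉ frame75a_KS2 by
      simp only [frame75a_KS2, List.mem_cons, Prod.mk.injEq, List.not_mem_nil, or_false, not_or, not_and]
      omega))

/-- LAW L frame `75a` = `7×5 ∖ (3, 2)` with the kill cell `(1, 4)` removed alone. [cite: GlazmanManolescu2019, §2.1 (finite domains of faces)] -/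
def frame75a_KN1 : List Face := [(0,0),(0,1),(0,2),(0,3),(0,4),(1,0),(1,1),(1,2),(1,3),(2,0),(2,1),(2,2),(2,3),(2,4),(3,0),(3,1),(3,3),(3,4),(4,0),(4,1),(4,2),(4,3),(4,4),(5,0),(5,1),(5,2),(5,3),(5,4),(6,0),(6,1),(6,2),(6,3),(6,4)]

/-- ★ LAW L, frame `75a`, cell `(1, 4)` (KN1): the predicted sign, as a closed theorem. [cite: GlazmanManolescu2019, Lemma 2.1 (statement, "in the form given in [Gl]")] -/
theorem frame75a_KN1_sign : (vertexFunctional (printedWeights (2 * π / 3)) tFiveEighths (ybCoeff (2 * π / 3)) frame75a_KN1 (Face.side (4, 2) .W) (farW (4, 2))).im < 0 :=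
  im_vertexFunctional_printed_two_pi_div_three_neg_of_killNW_block' (Dl := frame75a_KN1) (w := (4, 2)) (by decide)
    (show holeFaceW (4, 2) ∉ frame75a_KN1 by decide) (show killNW (4, 2) ∉ frame75a_KN1 by decide)
    (fun y hy => Or.inl (show ((_ : ℤ), y) ∉ frame75a_KN1 by
      simp only [frame75a_KN1, List.mem_cons, Prod.mk.injEq, List.not_mem_nil, or_false, not_or, not_and]
      omega))

/-- LAW L frame `75a` = `7×5 ∖ (3, 2)` with the kill cell `(5, 0)` removed alone. [cite: GlazmanManolescu2019, §2.1 (finite domains of faces)] -/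
def frame75a_KS1 : List Face := [(0,0),(0,1),(0,2),(0,3),(0,4),(1,0),(1,1),(1,2),(1,3),(1,4),(2,0),(2,1),(2,2),(2,3),(2,4),(3,0),(3,1),(3,3),(3,4),(4,0),(4,1),(4,2),(4,3),(4,4),(5,1),(5,2),(5,3),(5,4),(6,0),(6,1),(6,2),(6,3),(6,4)]

/-- ★ LAW L, frame `75a`, cell `(5, 0)` (KS1): the predicted sign, as a closed theorem. [cite: GlazmanManolescu2019, Lemma 2.1 (statement, "in the form given in [Gl]")] -/
theorem frame75a_KS1_sign : 0 < (vertexFunctional (printedWeights (2 * π / 3)) tFiveEighths (ybCoeff (2 * π / 3)) frame75a_KS1 (Face.side (4, 2) .W) (farW (4, 2))).im :=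
  im_vertexFunctional_printed_two_pi_div_three_pos_of_killSE_block (Dl := frame75a_KS1) (w := (4, 2)) (by decide)
    (show holeFaceW (4, 2) ∉ frame75a_KS1 by decide) (show killSE (4, 2) ∉ frame75a_KS1 by decide)
    (fun y hy => Or.inl (show ((_ : ℤ), y) ∉ frame75a_KS1 by
      simp only [frame75a_KS1, List.mem_cons, Prod.mk.injEq, List.not_mem_nil, or_false, not_or, not_and]
      omega))

/-- LAW L frame `75a` = `7×5 ∖ (3, 2)` with the kill cell `(5, 4)` removed alone. [cite: GlazmanManolescu2019, §2.1 (finite domains of faces)] -/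
def frame75a_KN2 : List Face := [(0,0),(0,1),(0,2),(0,3),(0,4),(1,0),(1,1),(1,2),(1,3),(1,4),(2,0),(2,1),(2,2),(2,3),(2,4),(3,0),(3,1),(3,3),(3,4),(4,0),(4,1),(4,2),(4,3),(4,4),(5,0),(5,1),(5,2),(5,3),(6,0),(6,1),(6,2),(6,3),(6,4)]

/-- ★ LAW L, frame `75a`, cell `(5, 4)` (KN2): the predicted sign, as a closed theorem. [cite: GlazmanManolescu2019, Lemma 2.1 (statement, "in the form given in [Gl]")] -/
theorem frame75a_KN2_sign : (vertexFunctional (printedWeights (π / 3)) tFiveEighths (ybCoeff (π / 3)) frame75a_KN2 (Face.side (4, 2) .W) (farW (4, 2))).im < 0 :=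
  im_vertexFunctional_printed_pi_div_three_neg_of_killNE_block (Dl := frame75a_KN2) (w := (4, 2)) (by decide)
    (show holeFaceW (4, 2) ∉ frame75a_KN2 by decide) (show killNE (4, 2) ∉ frame75a_KN2 by decide)
    (fun y hy => Or.inl (show ((_ : ℤ), y) ∉ frame75a_KN2 by
      simp only [frame75a_KN2, List.mem_cons, Prod.mk.injEq, List.not_mem_nil, or_false, not_or, not_and]
      omega))

/-- LAW L frame `66c` = `6×6 ∖ (2, 3)` with the kill cell `(0, 1)` removed alone. [cite: GlazmanManolescu2019, §2.1 (finite domains of faces)] -/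
def frame66c_KS2 : List Face := [(0,0),(0,2),(0,3),(0,4),(0,5),(1,0),(1,1),(1,2),(1,3),(1,4),(1,5),(2,0),(2,1),(2,2),(2,4),(2,5),(3,0),(3,1),(3,2),(3,3),(3,4),(3,5),(4,0),(4,1),(4,2),(4,3),(4,4),(4,5),(5,0),(5,1),(5,2),(5,3),(5,4),(5,5)]

/-- ★ LAW L, frame `66c`, cell `(0, 1)` (KS2): the predicted sign, as a closed theorem. [cite: GlazmanManolescu2019, Lemma 2.1 (statement, "in the form given in [Gl]")] -/
theorem frame66c_KS2_sign : 0 < (vertexFunctional (printedWeights (π / 3)) tFiveEighths (ybCoeff (π / 3)) frame66c_KS2 (Face.side (3, 3) .W) (farW (3, 3))).im :=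
  im_vertexFunctional_printed_pi_div_three_pos_of_killSW_block' (Dl := frame66c_KS2) (w := (3, 3)) (by decide)
    (show holeFaceW (3, 3) ∉ frame66c_KS2 by decide) (show killSW (3, 3) ∉ frame66c_KS2 by decide)
    (fun y hy => by
      rcases (show y = 0 ∨ y ≤ -1 by simp only at hy; omega) with rfl | hy'
      · -- the corner cell `(0,0)` is a dead end: `(-1,0)`, `(0,-1)` outside the box, `(0,1)` the kill cell
        exact Or.inr (Or.inr ⟨show ((3 : ℤ) - 4, (0 : ℤ)) ∉ frame66c_KS2 by decide,
          show ((3 : ℤ) - 3, (0 : ℤ) - 1) ∉ frame66c_KS2 by decide, show ((3 : ℤ) - 3, (0 : ℤ) + 1) ∉ frame66c_KS2 by decide⟩)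
      · exact Or.inl (show ((3 : ℤ) - 3, y) ∉ frame66c_KS2 by
          simp only [frame66c_KS2, List.mem_cons, Prod.mk.injEq, List.not_mem_nil, or_false, not_or, not_and]
          omega))

/-- LAW L frame `66c` = `6×6 ∖ (2, 3)` with the kill cell `(0, 5)` removed alone. [cite: GlazmanManolescu2019, §2.1 (finite domains of faces)] -/
def frame66c_KN1 : List Face := [(0,0),(0,1),(0,2),(0,3),(0,4),(1,0),(1,1),(1,2),(1,3),(1,4),(1,5),(2,0),(2,1),(2,2),(2,4),(2,5),(3,0),(3,1),(3,2),(3,3),(3,4),(3,5),(4,0),(4,1),(4,2),(4,3),(4,4),(4,5),(5,0),(5,1),(5,2),(5,3),(5,4),(5,5)]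

/-- ★ LAW L, frame `66c`, cell `(0, 5)` (KN1): the predicted sign, as a closed theorem. [cite: GlazmanManolescu2019, Lemma 2.1 (statement, "in the form given in [Gl]")] -/
theorem frame66c_KN1_sign : (vertexFunctional (printedWeights (2 * π / 3)) tFiveEighths (ybCoeff (2 * π / 3)) frame66c_KN1 (Face.side (3, 3) .W) (farW (3, 3))).im < 0 :=
  im_vertexFunctional_printed_two_pi_div_three_neg_of_killNW_block' (Dl := frame66c_KN1) (w := (3, 3)) (by decide)
    (show holeFaceW (3, 3) ∉ frame66c_KN1 by decide) (show killNW (3, 3) ∉ frame66c_KN1 by decide)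
    (fun y hy => Or.inl (show ((_ : ℤ), y) ∉ frame66c_KN1 by
      simp only [frame66c_KN1, List.mem_cons, Prod.mk.injEq, List.not_mem_nil, or_false, not_or, not_and]
      omega))

/-- LAW L frame `66c` = `6×6 ∖ (2, 3)` with the kill cell `(4, 5)` removed alone. [cite: GlazmanManolescu2019, §2.1 (finite domains of faces)] -/
def frame66c_KN2 : List Face := [(0,0),(0,1),(0,2),(0,3),(0,4),(0,5),(1,0),(1,1),(1,2),(1,3),(1,4),(1,5),(2,0),(2,1),(2,2),(2,4),(2,5),(3,0),(3,1),(3,2),(3,3),(3,4),(3,5),(4,0),(4,1),(4,2),(4,3),(4,4),(5,0),(5,1),(5,2),(5,3),(5,4),(5,5)]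

/-- ★ LAW L, frame `66c`, cell `(4, 5)` (KN2): the predicted sign, as a closed theorem. [cite: GlazmanManolescu2019, Lemma 2.1 (statement, "in the form given in [Gl]")] -/
theorem frame66c_KN2_sign : (vertexFunctional (printedWeights (π / 3)) tFiveEighths (ybCoeff (π / 3)) frame66c_KN2 (Face.side (3, 3) .W) (farW (3, 3))).im < 0 :=
  im_vertexFunctional_printed_pi_div_three_neg_of_killNE_block (Dl := frame66c_KN2) (w := (3, 3)) (by decide)
    (show holeFaceW (3, 3) ∉ frame66c_KN2 by decide) (show killNE (3, 3) ∉ frame66c_KN2 by decide)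
    (fun y hy => Or.inl (show ((_ : ℤ), y) ∉ frame66c_KN2 by
      simp only [frame66c_KN2, List.mem_cons, Prod.mk.injEq, List.not_mem_nil, or_false, not_or, not_and]
      omega))

/-- LAW L frame `85b` = `8×5 ∖ (4, 2)` with the kill cell `(2, 0)` removed alone. [cite: GlazmanManolescu2019, §2.1 (finite domains of faces)] -/
def frame85b_KS2 : List Face := [(0,0),(0,1),(0,2),(0,3),(0,4),(1,0),(1,1),(1,2),(1,3),(1,4),(2,1),(2,2),(2,3),(2,4),(3,0),(3,1),(3,2),(3,3),(3,4),(4,0),(4,1),(4,3),(4,4),(5,0),(5,1),(5,2),(5,3),(5,4),(6,0),(6,1),(6,2),(6,3),(6,4),(7,0),(7,1),(7,2),(7,3),(7,4)]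

/-- ★ LAW L, frame `85b`, cell `(2, 0)` (KS2): the predicted sign, as a closed theorem. [cite: GlazmanManolescu2019, Lemma 2.1 (statement, "in the form given in [Gl]")] -/
theorem frame85b_KS2_sign : 0 < (vertexFunctional (printedWeights (π / 3)) tFiveEighths (ybCoeff (π / 3)) frame85b_KS2 (Face.side (5, 2) .W) (farW (5, 2))).im :=
  im_vertexFunctional_printed_pi_div_three_pos_of_killSW_block' (Dl := frame85b_KS2) (w := (5, 2)) (by decide)
    (show holeFaceW (5, 2) ∉ frame85b_KS2 by decide) (show killSW (5, 2) ∉ frame85b_KS2 by decide)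
    (fun y hy => Or.inl (show ((_ : ℤ), y) ∉ frame85b_KS2 by
      simp only [frame85b_KS2, List.mem_cons, Prod.mk.injEq, List.not_mem_nil, or_false, not_or, not_and]
      omega))

/-- LAW L frame `85b` = `8×5 ∖ (4, 2)` with the kill cell `(2, 4)` removed alone. [cite: GlazmanManolescu2019, §2.1 (finite domains of faces)] -/
def frame85b_KN1 : List Face := [(0,0),(0,1),(0,2),(0,3),(0,4),(1,0),(1,1),(1,2),(1,3),(1,4),(2,0),(2,1),(2,2),(2,3),(3,0),(3,1),(3,2),(3,3),(3,4),(4,0),(4,1),(4,3),(4,4),(5,0),(5,1),(5,2),(5,3),(5,4),(6,0),(6,1),(6,2),(6,3),(6,4),(7,0),(7,1),(7,2),(7,3),(7,4)]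

/-- ★ LAW L, frame `85b`, cell `(2, 4)` (KN1): the predicted sign, as a closed theorem. [cite: GlazmanManolescu2019, Lemma 2.1 (statement, "in the form given in [Gl]")] -/
theorem frame85b_KN1_sign : (vertexFunctional (printedWeights (2 * π / 3)) tFiveEighths (ybCoeff (2 * π / 3)) frame85b_KN1 (Face.side (5, 2) .W) (farW (5, 2))).im < 0 :=
  im_vertexFunctional_printed_two_pi_div_three_neg_of_killNW_block' (Dl := frame85b_KN1) (w := (5, 2)) (by decide)
    (show holeFaceW (5, 2) ∉ frame85b_KN1 by decide) (show killNW (5, 2) ∉ frame85b_KN1 by decide)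
    (fun y hy => Or.inl (show ((_ : ℤ), y) ∉ frame85b_KN1 by
      simp only [frame85b_KN1, List.mem_cons, Prod.mk.injEq, List.not_mem_nil, or_false, not_or, not_and]
      omega))

/-- LAW L frame `85b` = `8×5 ∖ (4, 2)` with the kill cell `(6, 0)` removed alone. [cite: GlazmanManolescu2019, §2.1 (finite domains of faces)] -/
def frame85b_KS1 : List Face := [(0,0),(0,1),(0,2),(0,3),(0,4),(1,0),(1,1),(1,2),(1,3),(1,4),(2,0),(2,1),(2,2),(2,3),(2,4),(3,0),(3,1),(3,2),(3,3),(3,4),(4,0),(4,1),(4,3),(4,4),(5,0),(5,1),(5,2),(5,3),(5,4),(6,1),(6,2),(6,3),(6,4),(7,0),(7,1),(7,2),(7,3),(7,4)]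

/-- ★ LAW L, frame `85b`, cell `(6, 0)` (KS1): the predicted sign, as a closed theorem. [cite: GlazmanManolescu2019, Lemma 2.1 (statement, "in the form given in [Gl]")] -/
theorem frame85b_KS1_sign : 0 < (vertexFunctional (printedWeights (2 * π / 3)) tFiveEighths (ybCoeff (2 * π / 3)) frame85b_KS1 (Face.side (5, 2) .W) (farW (5, 2))).im :=
  im_vertexFunctional_printed_two_pi_div_three_pos_of_killSE_block (Dl := frame85b_KS1) (w := (5, 2)) (by decide)
    (show holeFaceW (5, 2) ∉ frame85b_KS1 by decide) (show killSE (5, 2) ∉ frame85b_KS1 by decide)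
    (fun y hy => Or.inl (show ((_ : ℤ), y) ∉ frame85b_KS1 by
      simp only [frame85b_KS1, List.mem_cons, Prod.mk.injEq, List.not_mem_nil, or_false, not_or, not_and]
      omega))

/-- LAW L frame `85b` = `8×5 ∖ (4, 2)` with the kill cell `(6, 4)` removed alone. [cite: GlazmanManolescu2019, §2.1 (finite domains of faces)] -/
def frame85b_KN2 : List Face := [(0,0),(0,1),(0,2),(0,3),(0,4),(1,0),(1,1),(1,2),(1,3),(1,4),(2,0),(2,1),(2,2),(2,3),(2,4),(3,0),(3,1),(3,2),(3,3),(3,4),(4,0),(4,1),(4,3),(4,4),(5,0),(5,1),(5,2),(5,3),(5,4),(6,0),(6,1),(6,2),(6,3),(7,0),(7,1),(7,2),(7,3),(7,4)]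

/-- ★ LAW L, frame `85b`, cell `(6, 4)` (KN2): the predicted sign, as a closed theorem. [cite: GlazmanManolescu2019, Lemma 2.1 (statement, "in the form given in [Gl]")] -/
theorem frame85b_KN2_sign : (vertexFunctional (printedWeights (π / 3)) tFiveEighths (ybCoeff (π / 3)) frame85b_KN2 (Face.side (5, 2) .W) (farW (5, 2))).im < 0 :=
  im_vertexFunctional_printed_pi_div_three_neg_of_killNE_block (Dl := frame85b_KN2) (w := (5, 2)) (by decide)
    (show holeFaceW (5, 2) ∉ frame85b_KN2 by decide) (show killNE (5, 2) ∉ frame85b_KN2 by decide)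
    (fun y hy => Or.inl (show ((_ : ℤ), y) ∉ frame85b_KN2 by
      simp only [frame85b_KN2, List.mem_cons, Prod.mk.injEq, List.not_mem_nil, or_false, not_or, not_and]
      omega))

end Literature.Barriers.CriticalPhenomena.PlaquetteWalk
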